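import Mathlib
import Summits.AtomisticToContinuum.HydrodynamicLimit.Theorems.OneSphereInfluenceStaticScoreResponseBaseChange
import Summits.AtomisticToContinuum.HydrodynamicLimit.Theorems.OneSphereInfluenceStaticScoreResponseLLNBridge
import Summits.AtomisticToContinuum.HydrodynamicLimit.Theorems.OneSphereInfluenceStaticScoreResponseRealAnalysis
import HarnessLib

/-!
# `StaticScoreResponse` (support item stmt-AtomisticToContinuum-12269): the canonical variances
# converge uniformly along a continuous homotopy of activities

The analytic heart of the static score response. Along a homotopy `κ ↦ a κ` (`κ ∈ [0,1]`) of
continuous positive activities on `𝕋³`, pinched between constants `0 < m₀ ≤ a ≤ M₀`, and a family of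
continuous observables `|G κ| ≤ 1`, both uniformly continuous in `κ` (sup norm, resp. sup norm of
`log a`), and at a reduced density `σ` small enough for all normalised profiles with
`M ≤ M₀ e² / m₀` (`exists_sigma_small`), the normalised canonical variances

`V_N(κ) = (N+1)⁻¹ Var_{a_κ}(∑ᵢ G_κ(xᵢ))` under `posGibbsMeasure (a κ) ε_N (N+1)`, `ε_N = σ(N+1)^{-1/3}`,

form a UNIFORMLY CAUCHY sequence of functions of `κ ∈ [0,1]` (`uniformCauchySeqOn_variance`).

Proof: `uniformCauchySeqOn_of_taylor_bound` with the tilted means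
`D_N(κ, s) = E_{a_κ e^{sG_κ}}[(N+1)⁻¹ ∑ G_κ]`: the Taylor bound is `tilted_mean_taylor_bound`
(Cauchy estimates, uniform in `N`); for each tilt `s` the means are uniformly Cauchy in `κ` by
`uniformCauchySeqOn_of_equicontinuous` — pointwise they converge by the tree's law of large numbers
(`tendsto_mean`), and they are equicontinuous in `κ` uniformly in `N` by `abs_integral_avg_sum_le`
(change of observable) and `mean_base_change_le` (change of activity) — exported separately as
`equicontinuous_tilted_mean` (with an observable family `R` possibly different from the tilt direction
`G`), together with the consequence that the variances `V_N` are themselves equicontinuous in `κ`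
uniformly in `N` (`equicontinuous_variance`, from the Taylor bound). Folklore; no definitions, no
named facts.
-/

noncomputable section

namespace Summit.AtomisticToContinuum.HydrodynamicLimit.Theorems

open Finset MeasureTheory Metric Set Filter Topology
  Literature.MathematicalPhysics.StatisticalMechanics Literature.MathematicalPhysics.KineticTheory

/-- Exponential tilts by exponents of size `≤ 1` keep an activity pinched in `[m₀, M₀]` inside
`[m₀/e, M₀ e]`. [folklore] -/
theorem tilt_mem_envelope {f t : T3 → ℝ} {m₀ M₀ : ℝ} (hm₀ : 0 < m₀) (hf : ∀ x, m₀ ≤ f x ∧ f x ≤ M₀)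
    (ht : ∀ x, |t x| ≤ 1) (x : T3) :
    m₀ * Real.exp (-1) ≤ f x * Real.exp (t x) ∧ f x * Real.exp (t x) ≤ M₀ * Real.exp 1 := by
  obtain ⟨h1, h2⟩ := hf x
  have ht' := abs_le.1 (ht x)
  have hM₀ : 0 ≤ M₀ := hm₀.le.trans (h1.trans h2)
  constructor
  · exact mul_le_mul h1 (Real.exp_le_exp.2 ht'.1) (Real.exp_nonneg _) (hm₀.le.trans h1)
  · exact mul_le_mul h2 (Real.exp_le_exp.2 ht'.2) (Real.exp_nonneg _) hM₀

/-- Smallness of every continuous activity in the envelope `[m₀/e, M₀ e]` when `σ` is small for all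
normalised profiles with `M ≤ M₀ e² / m₀`. [folklore] -/
theorem smallness_of_envelope {f : T3 → ℝ} (hf : Continuous f) (hf0 : ∀ x, 0 < f x) {m₀ M₀ σ : ℝ} (hm₀ : 0 < m₀)
    (hsm : ∀ P : DensityProfile, P.M ≤ M₀ * Real.exp 2 / m₀ →
      SmallDensity P σ ∧ 2 * (2 * Real.exp (1 / 4)) ^ 2 * Real.exp 1 ^ 4 * (P.M * v₁ * σ ^ 3) ≤ 1)
    (hfenv : ∀ x, m₀ * Real.exp (-1) ≤ f x ∧ f x ≤ M₀ * Real.exp 1) :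
    SmallDensity (profileOf f hf hf0) σ ∧ ∀ N : ℕ, 2 * (2 * Real.exp (1 / 4)) ^ 2 * Real.exp 1 ^ 4 *
      (((N + 1 : ℕ) : ℝ) * pOv (profileOf f hf hf0) (hsDiameter σ N)) ≤ 1 := by
  have hM : (profileOf f hf hf0).M ≤ M₀ * Real.exp 2 / m₀ := by
    have h := profileOf_M_le hf hf0 (mul_pos hm₀ (Real.exp_pos _)) (fun x => (hfenv x).1) fun x => (hfenv x).2
    refine h.trans (le_of_eq ?_)
    rw [show (2 : ℝ) = 1 - (-1) by norm_num, Real.exp_sub]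
    field_simp
  obtain ⟨hsd, hkp⟩ := hsm _ hM
  exact ⟨hsd, fun N => by rwa [succ_mul_pOv]⟩

/-- **Equicontinuity of the tilted means, uniformly in `N`.** Along the homotopy, for a fixed tilt
`|s| ≤ 1/32` in the direction `G_κ` and an observable family `R_κ` (`|G|, |R| ≤ 1`, both uniformly
continuous in `κ` together with `log a`), the means `E_{a_κ e^{sG_κ}}[(N+1)⁻¹ ∑ R_κ]` are
equicontinuous in `κ ∈ [0,1]` uniformly in `N` (change of observable: `abs_integral_avg_sum_le`;
change of activity: `mean_base_change_le`). [folklore] -/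
theorem equicontinuous_tilted_mean {a G R : ℝ → T3 → ℝ} {m₀ M₀ σ : ℝ}
    (ha : ∀ κ ∈ Icc (0 : ℝ) 1, Continuous (a κ)) (ha0 : ∀ κ ∈ Icc (0 : ℝ) 1, ∀ x, 0 < a κ x)
    (hG : ∀ κ ∈ Icc (0 : ℝ) 1, Continuous (G κ)) (hG1 : ∀ κ ∈ Icc (0 : ℝ) 1, ∀ x, |G κ x| ≤ 1)
    (hR : ∀ κ ∈ Icc (0 : ℝ) 1, Continuous (R κ)) (hR1 : ∀ κ ∈ Icc (0 : ℝ) 1, ∀ x, |R κ x| ≤ 1)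
    (hm₀ : 0 < m₀) (hmM : ∀ κ ∈ Icc (0 : ℝ) 1, ∀ x, m₀ ≤ a κ x ∧ a κ x ≤ M₀)
    (hmod : ∀ η > (0 : ℝ), ∃ ρ > (0 : ℝ), ∀ κ ∈ Icc (0 : ℝ) 1, ∀ κ' ∈ Icc (0 : ℝ) 1, |κ' - κ| < ρ → ∀ x,
      |Real.log (a κ' x) - Real.log (a κ x)| ≤ η ∧ |G κ' x - G κ x| ≤ η ∧ |R κ' x - R κ x| ≤ η)
    (hσ : 0 < σ) (hσ2 : σ < 1 / 2)
    (hsm : ∀ P : DensityProfile, P.M ≤ M₀ * Real.exp 2 / m₀ →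
      SmallDensity P σ ∧ 2 * (2 * Real.exp (1 / 4)) ^ 2 * Real.exp 1 ^ 4 * (P.M * v₁ * σ ^ 3) ≤ 1)
    {s : ℝ} (hsabs : |s| ≤ 1 / 32) :
    ∀ ε' > (0 : ℝ), ∃ ρ > (0 : ℝ), ∀ N : ℕ, ∀ κ ∈ Icc (0 : ℝ) 1, ∀ κ' ∈ Icc (0 : ℝ) 1, dist κ κ' < ρ →
      dist (∫ x, (((N + 1 : ℕ) : ℝ))⁻¹ * ∑ i, R κ (x i)
          ∂posGibbsMeasure (fun x => a κ x * Real.exp (s * G κ x)) (hsDiameter σ N) (N + 1))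
        (∫ x, (((N + 1 : ℕ) : ℝ))⁻¹ * ∑ i, R κ' (x i)
          ∂posGibbsMeasure (fun x => a κ' x * Real.exp (s * G κ' x)) (hsDiameter σ N) (N + 1)) < ε' := by
  have hε0 : ∀ N : ℕ, 0 ≤ hsDiameter σ N := fun N => (hsDiameter_pos hσ N).le
  have hε2 : ∀ N : ℕ, hsDiameter σ N < 1 / 2 := fun N => hsDiameter_lt_half hσ.le hσ2 N
  have henv : ∀ κ ∈ Icc (0 : ℝ) 1, ∀ t : T3 → ℝ, (∀ x, |t x| ≤ 1) → ∀ x,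
      m₀ * Real.exp (-1) ≤ a κ x * Real.exp (t x) ∧ a κ x * Real.exp (t x) ≤ M₀ * Real.exp 1 :=
    fun κ hκ t ht x => tilt_mem_envelope hm₀ (hmM κ hκ) ht x
  have hbs : ∀ κ ∈ Icc (0 : ℝ) 1, Continuous fun x => a κ x * Real.exp (s * G κ x) :=
    fun κ hκ => LocalGibbsConcentration.continuous_tilt (ha κ hκ) (hG κ hκ) s
  have hbs0 : ∀ κ ∈ Icc (0 : ℝ) 1, ∀ x, 0 < a κ x * Real.exp (s * G κ x) :=
    fun κ hκ => LocalGibbsConcentration.tilt_pos (ha0 κ hκ) (G κ) s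
  have hsG' : ∀ κ ∈ Icc (0 : ℝ) 1, ∀ x, |s * G κ x| ≤ 1 / 32 := fun κ hκ x => by
    rw [abs_mul]; nlinarith [hG1 κ hκ x, abs_nonneg s, abs_nonneg (G κ x)]
  intro ε' hε'
  set η : ℝ := min (1 / 8) (ε' / 6146) with hηdef
  have hη0 : 0 < η := lt_min (by norm_num) (by positivity)
  have hη8 : η ≤ 1 / 8 := min_le_left _ _
  have hηε : η / 2 + 3072 * η < ε' := by
    have : η ≤ ε' / 6146 := min_le_right _ _
    nlinarith
  obtain ⟨ρ, hρ, hρmod⟩ := hmod (η / 2) (half_pos hη0)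
  refine ⟨ρ, hρ, fun N κ hκ κ' hκ' hdist => ?_⟩
  rw [Real.dist_eq] at hdist ⊢
  have hdist' : |κ' - κ| < ρ := by rwa [abs_sub_comm]
  have hmodx := hρmod κ hκ κ' hκ' hdist'
  set n : ℕ := N + 1 with hn
  set ε := hsDiameter σ N with hεdef
  -- the two activities and the connecting exponent
  set b : T3 → ℝ := fun x => a κ x * Real.exp (s * G κ x) with hbdef
  set b' : T3 → ℝ := fun x => a κ' x * Real.exp (s * G κ' x) with hb'def
  set H : T3 → ℝ := fun x => (Real.log (a κ' x) - Real.log (a κ x)) + s * (G κ' x - G κ x) with hHdef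
  have hHc : Continuous H := by
    have h1 : Continuous fun x => Real.log (a κ' x) := (ha κ' hκ').log fun x => (ha0 κ' hκ' x).ne'
    have h2 : Continuous fun x => Real.log (a κ x) := (ha κ hκ).log fun x => (ha0 κ hκ x).ne'
    have h3 := hG κ hκ
    have h4 := hG κ' hκ'
    rw [hHdef]; fun_prop
  have hHη : ∀ x, |H x| ≤ η := fun x => by
    obtain ⟨h1, h2, -⟩ := hmodx x
    rw [hHdef]; dsimp only
    calc |Real.log (a κ' x) - Real.log (a κ x) + s * (G κ' x - G κ x)|
        ≤ |Real.log (a κ' x) - Real.log (a κ x)| + |s * (G κ' x - G κ x)| := abs_add_le _ _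
      _ ≤ η / 2 + 1 / 32 * (η / 2) := by
          rw [abs_mul]
          exact add_le_add h1 (mul_le_mul hsabs h2 (abs_nonneg _) (by norm_num))
      _ ≤ η := by linarith
  have hbb' : (fun x => b x * Real.exp (H x)) = b' := by
    funext x
    rw [hbdef, hb'def, hHdef]; dsimp only
    rw [mul_assoc, ← Real.exp_add]
    have e1 : s * G κ x + (Real.log (a κ' x) - Real.log (a κ x) + s * (G κ' x - G κ x)) =
        Real.log (a κ' x) + (s * G κ' x - Real.log (a κ x)) := by ring
    rw [e1, Real.exp_add, Real.exp_log (ha0 κ' hκ' x), Real.exp_sub, Real.exp_log (ha0 κ hκ x)]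
    have := (ha0 κ hκ x).ne'
    field_simp
  -- first: change of observable under `b'`
  haveI : IsProbabilityMeasure (posGibbsMeasure b' ε n) :=
    isProbabilityMeasure_posGibbsMeasure (hbs κ' hκ') (hbs0 κ' hκ') hσ2.le N
  have hobs : |(∫ x, (n : ℝ)⁻¹ * ∑ i, R κ' (x i) ∂posGibbsMeasure b' ε n) -
      (∫ x, (n : ℝ)⁻¹ * ∑ i, R κ (x i) ∂posGibbsMeasure b' ε n)| ≤ η / 2 := by
    have hint : ∀ {χ : T3 → ℝ}, Continuous χ → (∀ x, |χ x| ≤ 1) →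
        Integrable (fun x : Fin n → T3 => (n : ℝ)⁻¹ * ∑ i, χ (x i)) (posGibbsMeasure b' ε n) :=
      fun hχ hχ1 => Integrable.mono' (integrable_const 1) (measurable_avg_sum hχ n).aestronglyMeasurable
        (ae_of_all _ fun x => (Real.norm_eq_abs _).le.trans (abs_avg_sum_le hχ1 x))
    rw [← integral_sub (hint (hR κ' hκ') (hR1 κ' hκ')) (hint (hR κ hκ) (hR1 κ hκ))]
    have hrw : ∀ x : Fin n → T3, (n : ℝ)⁻¹ * ∑ i, R κ' (x i) - (n : ℝ)⁻¹ * ∑ i, R κ (x i) =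
        (n : ℝ)⁻¹ * ∑ i, (R κ' (x i) - R κ (x i)) := fun x => by
      rw [Finset.sum_sub_distrib]; ring
    simp_rw [hrw]
    exact abs_integral_avg_sum_le (χ := fun y => R κ' y - R κ y) (half_pos hη0).le fun y => (hmodx y).2.2
  -- second: change of activity for the observable `R κ`
  have hbase : |(∫ x, (n : ℝ)⁻¹ * ∑ i, R κ (x i) ∂posGibbsMeasure b' ε n) -
      (∫ x, (n : ℝ)⁻¹ * ∑ i, R κ (x i) ∂posGibbsMeasure b ε n)| ≤ 3072 * η := by
    rw [← hbb']
    refine mean_base_change_le (hbs κ hκ) (hbs0 κ hκ) hHc hη0 hη8 hHη (hR κ hκ) (hR1 κ hκ) (hε0 N) (hε2 N)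
      (Nat.succ_pos N) fun u hu => ?_
    refine (smallness_of_envelope _ _ hm₀ hsm fun x => ?_).2 N
    -- the doubly tilted activity stays in the envelope
    have h1 : ∀ y, |s * G κ y + u * (H y / η)| ≤ 1 := fun y => by
      have hu' : |u * (H y / η)| ≤ 1 / 4 := by
        rw [abs_mul, abs_div, abs_of_pos hη0]
        have : |H y| / η ≤ 1 := by rw [div_le_one hη0]; exact hHη y
        nlinarith [abs_nonneg u, div_nonneg (abs_nonneg (H y)) hη0.le]
      calc |s * G κ y + u * (H y / η)| ≤ |s * G κ y| + |u * (H y / η)| := abs_add_le _ _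
        _ ≤ 1 := by linarith [hsG' κ hκ y]
    have h2 := henv κ hκ (fun y => s * G κ y + u * (H y / η)) h1 x
    rw [mul_assoc, ← Real.exp_add]
    exact h2
  -- combine
  calc _ ≤ |(∫ x, (n : ℝ)⁻¹ * ∑ i, R κ (x i) ∂posGibbsMeasure b ε n) -
          (∫ x, (n : ℝ)⁻¹ * ∑ i, R κ (x i) ∂posGibbsMeasure b' ε n)| +
        |(∫ x, (n : ℝ)⁻¹ * ∑ i, R κ (x i) ∂posGibbsMeasure b' ε n) -
          (∫ x, (n : ℝ)⁻¹ * ∑ i, R κ' (x i) ∂posGibbsMeasure b' ε n)| := abs_sub_le _ _ _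
    _ ≤ 3072 * η + η / 2 := by
        rw [abs_sub_comm] at hbase hobs
        exact add_le_add hbase hobs
    _ < ε' := by linarith

/-- **The canonical variances are uniformly Cauchy along the homotopy.** See the module docstring.
The variance is written as `E[n⁻¹ S · S] - E[n⁻¹ S] E[S]`, `S = ∑ᵢ G_κ(xᵢ)`, `n = N + 1`. [folklore] -/
theorem uniformCauchySeqOn_variance {a G : ℝ → T3 → ℝ} {m₀ M₀ σ : ℝ}
    (ha : ∀ κ ∈ Icc (0 : ℝ) 1, Continuous (a κ)) (ha0 : ∀ κ ∈ Icc (0 : ℝ) 1, ∀ x, 0 < a κ x)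
    (hG : ∀ κ ∈ Icc (0 : ℝ) 1, Continuous (G κ)) (hG1 : ∀ κ ∈ Icc (0 : ℝ) 1, ∀ x, |G κ x| ≤ 1)
    (hm₀ : 0 < m₀) (hmM : ∀ κ ∈ Icc (0 : ℝ) 1, ∀ x, m₀ ≤ a κ x ∧ a κ x ≤ M₀)
    (hmod : ∀ η > (0 : ℝ), ∃ ρ > (0 : ℝ), ∀ κ ∈ Icc (0 : ℝ) 1, ∀ κ' ∈ Icc (0 : ℝ) 1, |κ' - κ| < ρ → ∀ x,
      |Real.log (a κ' x) - Real.log (a κ x)| ≤ η ∧ |G κ' x - G κ x| ≤ η)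
    (hσ : 0 < σ) (hσ2 : σ < 1 / 2)
    (hsm : ∀ P : DensityProfile, P.M ≤ M₀ * Real.exp 2 / m₀ →
      SmallDensity P σ ∧ 2 * (2 * Real.exp (1 / 4)) ^ 2 * Real.exp 1 ^ 4 * (P.M * v₁ * σ ^ 3) ≤ 1) :
    UniformCauchySeqOn (fun (N : ℕ) (κ : ℝ) =>
      (∫ x, ((((N + 1 : ℕ) : ℝ))⁻¹ * ∑ i, G κ (x i)) * ∑ i, G κ (x i)
          ∂posGibbsMeasure (a κ) (hsDiameter σ N) (N + 1)) -
        (∫ x, (((N + 1 : ℕ) : ℝ))⁻¹ * ∑ i, G κ (x i) ∂posGibbsMeasure (a κ) (hsDiameter σ N) (N + 1)) *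
          ∫ x, ∑ i, G κ (x i) ∂posGibbsMeasure (a κ) (hsDiameter σ N) (N + 1)) atTop (Icc 0 1) := by
  have hε0 : ∀ N : ℕ, 0 ≤ hsDiameter σ N := fun N => (hsDiameter_pos hσ N).le
  have hε2 : ∀ N : ℕ, hsDiameter σ N < 1 / 2 := fun N => hsDiameter_lt_half hσ.le hσ2 N
  have henv : ∀ κ ∈ Icc (0 : ℝ) 1, ∀ t : T3 → ℝ, (∀ x, |t x| ≤ 1) → ∀ x,
      m₀ * Real.exp (-1) ≤ a κ x * Real.exp (t x) ∧ a κ x * Real.exp (t x) ≤ M₀ * Real.exp 1 :=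
    fun κ hκ t ht x => tilt_mem_envelope hm₀ (hmM κ hκ) ht x
  have hmod3 : ∀ η > (0 : ℝ), ∃ ρ > (0 : ℝ), ∀ κ ∈ Icc (0 : ℝ) 1, ∀ κ' ∈ Icc (0 : ℝ) 1, |κ' - κ| < ρ → ∀ x,
      |Real.log (a κ' x) - Real.log (a κ x)| ≤ η ∧ |G κ' x - G κ x| ≤ η ∧ |G κ' x - G κ x| ≤ η := by
    intro η hη
    obtain ⟨ρ, hρ, h⟩ := hmod η hη
    exact ⟨ρ, hρ, fun κ hκ κ' hκ' hd x => ⟨(h κ hκ κ' hκ' hd x).1, (h κ hκ κ' hκ' hd x).2, (h κ hκ κ' hκ' hd x).2⟩⟩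
  -- the tilted means
  set D : ℕ → ℝ → ℝ → ℝ := fun N κ s => ∫ x, (((N + 1 : ℕ) : ℝ))⁻¹ * ∑ i, G κ (x i)
    ∂posGibbsMeasure (fun x => a κ x * Real.exp (s * G κ x)) (hsDiameter σ N) (N + 1) with hD
  refine uniformCauchySeqOn_of_taylor_bound (D := D) (K := 24576) (δ := 1 / 32) (by norm_num) (by norm_num) ?_ ?_
  · -- the Taylor bound
    intro N κ hκ s hs0 hs1
    have hs : |s| ≤ 1 / 32 := by rw [abs_of_pos hs0]; exact hs1
    have h := tilted_mean_taylor_bound (ha κ hκ) (ha0 κ hκ) (hG κ hκ) (hG1 κ hκ) (hε0 N) (hε2 N) (Nat.succ_pos N)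
      ((smallness_of_envelope (ha κ hκ) (ha0 κ hκ) hm₀ hsm (fun x => by
        have := henv κ hκ (fun _ => 0) (fun _ => by simp) x
        simpa using this)).2 N) hs
    rw [hD]
    dsimp only
    rw [tilt_zero]
    exact h
  · -- the tilted means are uniformly Cauchy in `κ` for every fixed tilt
    intro s hs0 hs1
    have hsabs : |s| ≤ 1 / 32 := by rw [abs_of_nonneg hs0]; exact hs1
    have hbs : ∀ κ ∈ Icc (0 : ℝ) 1, Continuous fun x => a κ x * Real.exp (s * G κ x) :=
      fun κ hκ => LocalGibbsConcentration.continuous_tilt (ha κ hκ) (hG κ hκ) s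
    have hbs0 : ∀ κ ∈ Icc (0 : ℝ) 1, ∀ x, 0 < a κ x * Real.exp (s * G κ x) :=
      fun κ hκ => LocalGibbsConcentration.tilt_pos (ha0 κ hκ) (G κ) s
    have hsG : ∀ κ ∈ Icc (0 : ℝ) 1, ∀ x, |s * G κ x| ≤ 1 := fun κ hκ x => by
      rw [abs_mul]; nlinarith [hG1 κ hκ x, abs_nonneg s, abs_nonneg (G κ x)]
    refine uniformCauchySeqOn_of_equicontinuous isCompact_Icc
      (equicontinuous_tilted_mean ha ha0 hG hG1 hG hG1 hm₀ hmM hmod3 hσ hσ2 hsm hsabs) ?_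
    -- pointwise convergence (the tree's law of large numbers)
    intro κ hκ
    have hsd := (smallness_of_envelope (hbs κ hκ) (hbs0 κ hκ) hm₀ hsm fun x => by
      have := henv κ hκ (fun x => s * G κ x) (hsG κ hκ) x
      simpa using this).1
    exact (tendsto_mean (hbs κ hκ) (hbs0 κ hκ) (hG κ hκ) hsd).cauchySeq

/-- **The canonical variances are equicontinuous in `κ`, uniformly in `N`** (Taylor bound plus
equicontinuity of the tilted means at two tilts). [folklore] -/
theorem equicontinuous_variance {a G : ℝ → T3 → ℝ} {m₀ M₀ σ : ℝ}
    (ha : ∀ κ ∈ Icc (0 : ℝ) 1, Continuous (a κ)) (ha0 : ∀ κ ∈ Icc (0 : ℝ) 1, ∀ x, 0 < a κ x)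
    (hG : ∀ κ ∈ Icc (0 : ℝ) 1, Continuous (G κ)) (hG1 : ∀ κ ∈ Icc (0 : ℝ) 1, ∀ x, |G κ x| ≤ 1)
    (hm₀ : 0 < m₀) (hmM : ∀ κ ∈ Icc (0 : ℝ) 1, ∀ x, m₀ ≤ a κ x ∧ a κ x ≤ M₀)
    (hmod : ∀ η > (0 : ℝ), ∃ ρ > (0 : ℝ), ∀ κ ∈ Icc (0 : ℝ) 1, ∀ κ' ∈ Icc (0 : ℝ) 1, |κ' - κ| < ρ → ∀ x,
      |Real.log (a κ' x) - Real.log (a κ x)| ≤ η ∧ |G κ' x - G κ x| ≤ η)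
    (hσ : 0 < σ) (hσ2 : σ < 1 / 2)
    (hsm : ∀ P : DensityProfile, P.M ≤ M₀ * Real.exp 2 / m₀ →
      SmallDensity P σ ∧ 2 * (2 * Real.exp (1 / 4)) ^ 2 * Real.exp 1 ^ 4 * (P.M * v₁ * σ ^ 3) ≤ 1) :
    ∀ ε' > (0 : ℝ), ∃ ρ > (0 : ℝ), ∀ N : ℕ, ∀ κ ∈ Icc (0 : ℝ) 1, ∀ κ' ∈ Icc (0 : ℝ) 1, dist κ κ' < ρ →
      dist ((∫ x, ((((N + 1 : ℕ) : ℝ))⁻¹ * ∑ i, G κ (x i)) * ∑ i, G κ (x i)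
            ∂posGibbsMeasure (a κ) (hsDiameter σ N) (N + 1)) -
          (∫ x, (((N + 1 : ℕ) : ℝ))⁻¹ * ∑ i, G κ (x i) ∂posGibbsMeasure (a κ) (hsDiameter σ N) (N + 1)) *
            ∫ x, ∑ i, G κ (x i) ∂posGibbsMeasure (a κ) (hsDiameter σ N) (N + 1))
        ((∫ x, ((((N + 1 : ℕ) : ℝ))⁻¹ * ∑ i, G κ' (x i)) * ∑ i, G κ' (x i)
            ∂posGibbsMeasure (a κ') (hsDiameter σ N) (N + 1)) -
          (∫ x, (((N + 1 : ℕ) : ℝ))⁻¹ * ∑ i, G κ' (x i) ∂posGibbsMeasure (a κ') (hsDiameter σ N) (N + 1)) *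
            ∫ x, ∑ i, G κ' (x i) ∂posGibbsMeasure (a κ') (hsDiameter σ N) (N + 1)) < ε' := by
  have hε0 : ∀ N : ℕ, 0 ≤ hsDiameter σ N := fun N => (hsDiameter_pos hσ N).le
  have hε2 : ∀ N : ℕ, hsDiameter σ N < 1 / 2 := fun N => hsDiameter_lt_half hσ.le hσ2 N
  have henv : ∀ κ ∈ Icc (0 : ℝ) 1, ∀ t : T3 → ℝ, (∀ x, |t x| ≤ 1) → ∀ x,
      m₀ * Real.exp (-1) ≤ a κ x * Real.exp (t x) ∧ a κ x * Real.exp (t x) ≤ M₀ * Real.exp 1 :=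
    fun κ hκ t ht x => tilt_mem_envelope hm₀ (hmM κ hκ) ht x
  have hmod3 : ∀ η > (0 : ℝ), ∃ ρ > (0 : ℝ), ∀ κ ∈ Icc (0 : ℝ) 1, ∀ κ' ∈ Icc (0 : ℝ) 1, |κ' - κ| < ρ → ∀ x,
      |Real.log (a κ' x) - Real.log (a κ x)| ≤ η ∧ |G κ' x - G κ x| ≤ η ∧ |G κ' x - G κ x| ≤ η := by
    intro η hη
    obtain ⟨ρ, hρ, h⟩ := hmod η hη
    exact ⟨ρ, hρ, fun κ hκ κ' hκ' hd x => ⟨(h κ hκ κ' hκ' hd x).1, (h κ hκ κ' hκ' hd x).2, (h κ hκ κ' hκ' hd x).2⟩⟩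
  -- the tilted means and the variances
  set D : ℕ → ℝ → ℝ → ℝ := fun N κ s => ∫ x, (((N + 1 : ℕ) : ℝ))⁻¹ * ∑ i, G κ (x i)
    ∂posGibbsMeasure (fun x => a κ x * Real.exp (s * G κ x)) (hsDiameter σ N) (N + 1) with hD
  set V : ℕ → ℝ → ℝ := fun N κ =>
    (∫ x, ((((N + 1 : ℕ) : ℝ))⁻¹ * ∑ i, G κ (x i)) * ∑ i, G κ (x i) ∂posGibbsMeasure (a κ) (hsDiameter σ N) (N + 1)) -
      (∫ x, (((N + 1 : ℕ) : ℝ))⁻¹ * ∑ i, G κ (x i) ∂posGibbsMeasure (a κ) (hsDiameter σ N) (N + 1)) *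
        ∫ x, ∑ i, G κ (x i) ∂posGibbsMeasure (a κ) (hsDiameter σ N) (N + 1) with hV
  -- the Taylor bound
  have hT : ∀ N, ∀ κ ∈ Icc (0 : ℝ) 1, ∀ s, |s| ≤ 1 / 32 → |D N κ s - D N κ 0 - s * V N κ| ≤ 24576 * s ^ 2 := by
    intro N κ hκ s hs
    have h := tilted_mean_taylor_bound (ha κ hκ) (ha0 κ hκ) (hG κ hκ) (hG1 κ hκ) (hε0 N) (hε2 N) (Nat.succ_pos N)
      ((smallness_of_envelope (ha κ hκ) (ha0 κ hκ) hm₀ hsm (fun x => by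
        have := henv κ hκ (fun _ => 0) (fun _ => by simp) x
        simpa using this)).2 N) hs
    rw [hD, hV]
    dsimp only
    rw [tilt_zero]
    exact h
  intro ε' hε'
  set K : ℝ := 24576 with hK
  set s : ℝ := min (1 / 32) (ε' / (4 * (K + 1))) with hsdef
  have hs0 : 0 < s := lt_min (by norm_num) (by positivity)
  have hs32 : s ≤ 1 / 32 := min_le_left _ _
  have hsabs : |s| ≤ 1 / 32 := by rw [abs_of_pos hs0]; exact hs32
  have h0abs : |(0 : ℝ)| ≤ 1 / 32 := by norm_num
  have hKs : 2 * K * s ≤ ε' / 2 := by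
    have h1 : s ≤ ε' / (4 * (K + 1)) := min_le_right _ _
    have hK1 : (0 : ℝ) < 4 * (K + 1) := by norm_num [hK]
    have h2 : s * (4 * (K + 1)) ≤ ε' := (le_div_iff₀ hK1).1 h1
    nlinarith [hK]
  obtain ⟨ρ₁, hρ₁, h₁⟩ := equicontinuous_tilted_mean ha ha0 hG hG1 hG hG1 hm₀ hmM hmod3 hσ hσ2 hsm hsabs
    (ε' * s / 8) (by positivity)
  obtain ⟨ρ₀, hρ₀, h₀⟩ := equicontinuous_tilted_mean ha ha0 hG hG1 hG hG1 hm₀ hmM hmod3 hσ hσ2 hsm h0abs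
    (ε' * s / 8) (by positivity)
  refine ⟨min ρ₁ ρ₀, lt_min hρ₁ hρ₀, fun N κ hκ κ' hκ' hdist => ?_⟩
  have hd₁ := h₁ N κ hκ κ' hκ' (lt_of_lt_of_le hdist (min_le_left _ _))
  have hd₀ := h₀ N κ hκ κ' hκ' (lt_of_lt_of_le hdist (min_le_right _ _))
  rw [Real.dist_eq] at hd₁ hd₀ ⊢
  have hDs : D N κ s = ∫ x, (((N + 1 : ℕ) : ℝ))⁻¹ * ∑ i, G κ (x i)
      ∂posGibbsMeasure (fun x => a κ x * Real.exp (s * G κ x)) (hsDiameter σ N) (N + 1) := rfl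
  have hDs' : D N κ' s = ∫ x, (((N + 1 : ℕ) : ℝ))⁻¹ * ∑ i, G κ' (x i)
      ∂posGibbsMeasure (fun x => a κ' x * Real.exp (s * G κ' x)) (hsDiameter σ N) (N + 1) := rfl
  have hD0 : D N κ 0 = ∫ x, (((N + 1 : ℕ) : ℝ))⁻¹ * ∑ i, G κ (x i)
      ∂posGibbsMeasure (fun x => a κ x * Real.exp (0 * G κ x)) (hsDiameter σ N) (N + 1) := rfl
  have hD0' : D N κ' 0 = ∫ x, (((N + 1 : ℕ) : ℝ))⁻¹ * ∑ i, G κ' (x i)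
      ∂posGibbsMeasure (fun x => a κ' x * Real.exp (0 * G κ' x)) (hsDiameter σ N) (N + 1) := rfl
  rw [← hDs, ← hDs'] at hd₁
  rw [← hD0, ← hD0'] at hd₀
  have hTκ := hT N κ hκ s hsabs
  have hTκ' := hT N κ' hκ' s hsabs
  -- `s (V κ - V κ') = (D_s κ - D_s κ') - (D_0 κ - D_0 κ') - T κ + T κ'`
  have hkey : |s * (V N κ - V N κ')| < s * (3 * ε' / 4) := by
    have hid : s * (V N κ - V N κ') = (D N κ s - D N κ' s) - (D N κ 0 - D N κ' 0)
        - (D N κ s - D N κ 0 - s * V N κ) + (D N κ' s - D N κ' 0 - s * V N κ') := by ring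
    rw [hid]
    have hss : 24576 * s ^ 2 + 24576 * s ^ 2 ≤ s * (ε' / 2) := by nlinarith [hKs, hs0]
    calc |(D N κ s - D N κ' s) - (D N κ 0 - D N κ' 0) - (D N κ s - D N κ 0 - s * V N κ)
          + (D N κ' s - D N κ' 0 - s * V N κ')|
        ≤ |D N κ s - D N κ' s| + |D N κ 0 - D N κ' 0| + |D N κ s - D N κ 0 - s * V N κ|
          + |D N κ' s - D N κ' 0 - s * V N κ'| := by
            refine (abs_add_le _ _).trans (add_le_add ((abs_sub _ _).trans (add_le_add (abs_sub _ _) le_rfl)) le_rfl)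
      _ < ε' * s / 8 + ε' * s / 8 + 24576 * s ^ 2 + 24576 * s ^ 2 := by linarith
      _ ≤ s * (3 * ε' / 4) := by nlinarith [hss, hs0]
  rw [abs_mul, abs_of_pos hs0] at hkey
  have h := lt_of_mul_lt_mul_left hkey hs0.le
  linarith

end Summit.AtomisticToContinuum.HydrodynamicLimit.Theorems

end
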